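import Literature.Computation.Certificates.SemidefiniteComplementarity

/-!
# Constraint Set Invariance: when restricting a semidefinite program to a subspace is lossless for
# the primal AND the dual (Permenter–Parrilo 2020, §2 Condition 1 and Proposition 1)

Source: F. Permenter, P. A. Parrilo, *Dimension reduction for semidefinite programs via Jordan algebras*,
Math. Program. 181 (2020) 51–84 = arXiv:1608.02090 [PermenterParrilo2016], §2 "Equivalent SDPs" (held text
`paper:arxiv-1608.02090` read: the primal–dual pair (sdp:main), Condition 1, Remark 1, the paragraph
"Condition 1 implies …", eq. (affinter), Proposition 1, Condition 2).

THE PAIR (their (sdp:main), "conic form (Chapter 4, [Nesterov–Nemirovskii 1994])"):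
`min ⟨C, X⟩ s.t. X ∈ Y + L, X ∈ Sⁿ₊` and `max −⟨Y, S⟩ s.t. S ∈ C + L^⊥, S ∈ Sⁿ₊`, on real symmetric
matrices "equipped with trace inner-product `⟨X, Y⟩ := trace XY`", `L` a linear subspace. (For the
standard form `⟨Aᵢ, X⟩ = bᵢ` of `SemidefiniteComplementarity`: `L = {X : ⟨Aᵢ, X⟩ = 0 ∀ i}`, `Y` any
particular solution, and every slack `C − Σ yᵢ Aᵢ` lies in `C + L^⊥` — `slack_mem_costAffine` below.)

> **Condition 1 (Constraint Set Invariance).** An orthogonal projection `P_S : Sⁿ → Sⁿ` leaves the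
> constraint sets invariant if (a) `P_S(Sⁿ₊) ⊆ Sⁿ₊`, i.e., `P_S` is a positive map; (b) `P_S(Y + L) ⊆ Y + L`;
> (c) `P_S(C + L^⊥) ⊆ C + L^⊥`.
> **Remark 1.** Note in symmetry reduction, the Reynolds operator satisfies constraints (a-b) and
> (typically) `P_S(C) = C`. It turns out these constraints imply (a-c).
> [Text] (b),(c) imply `X − P_S(X) ∈ L`, `C − P_S(C) ∈ L^⊥` … It follows `C · X = P_S(C) · P_S(X)` and,
> using the fact `P_S` is self-adjoint and idempotent, `P_S(C) · P_S(X) = C · P_S P_S(X) = C · P_S(X)`. Hence,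
> `P_S` maps a primal feasible point `X` to a primal feasible point with equal cost. By similar arguments,
> `P_S` also maps a dual feasible point `S` to a dual feasible point `P_S(S)` with equal cost. Hence, optimal
> solutions are mapped to optimal solutions for both primal and dual problems.
> [(affinter)] `(Y + L) ∩ S = P_S(Y) + L ∩ S` and `(C + L^⊥) ∩ S = P_S(C) + L^⊥ ∩ S`.
> **Proposition 1.** … treating `S` as the ambient space, the [restricted] pair … is a primal-dual pair …
> Moreover, primal (resp. dual) feasible points … and optimal solutions are primal (resp. dual) feasible
> points … and optimal solutions of (sdp:main); the primal (resp. dual) is feasible if and only if the primal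
> (resp. dual) of (sdp:main) is feasible; the primal (resp. dual) optimal value equals the primal (resp.
> dual) optimal value of (sdp:main).

This is the one printed statement under which SYMMETRY reduction (the Reynolds operator / `*`-algebra
projection of `InvariantConvexPrograms`, `InvariantSemidefinitePrograms`), SPARSITY reductions by coordinate
or partition subspaces (PP20 §4) and Jordan-algebra reductions (§3, §5) are all LOSSLESS, for the primal and
the dual simultaneously; the optimal admissible subspace of PP20 Thm 1–2 is the smallest `S` whose projection
satisfies it. We prove, in the namespace `Literature.Analysis.Convex.ConstraintSetInvariance`:

* `perp L` — `L^⊥` for the trace pairing; `IsCSIProjection P C Y L` — `P` linear, self-adjoint for the trace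
  pairing, idempotent, with (a), (b), (c) (Condition 1 for "an orthogonal projection");
* the mechanism: `sub_proj_mem` (`X − P X ∈ L` on `Y + L`), `cost_sub_proj_mem_perp` (`C − P C ∈ L^⊥`),
  `map_mem` / `map_mem_perp` (`P L ⊆ L`, `P L^⊥ ⊆ L^⊥`);
* **equal cost**: `frob_cost_proj` (`⟨C, P X⟩ = ⟨C, X⟩` for `X ∈ Y + L`) and `frob_rhs_proj`
  (`⟨Y, P S⟩ = ⟨Y, S⟩` for `S ∈ C + L^⊥`); **feasible ↦ feasible**: `primalFeasible_proj`, `dualFeasible_proj`;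
* **Proposition 1, values and optima**: `primal_values_eq`, `dual_values_eq` (the objective values attained
  on the feasible set and on its restriction to `range P = {X : P X = X}` coincide — hence equal optimal
  values, attained iff attained, feasible iff feasible) and `isMinOn_proj`, `isMaxOn_proj` (optimal ↦
  optimal restricted optimal); the affine identities (affinter): `primalAffine_inter_range_eq`,
  `dualAffine_inter_range_eq`;
* **Remark 1**: `of_reynolds` — self-adjoint + idempotent + (a) + (b) + `P C = C` ⇒ Condition 1;
* the bridge to standard form: `mem_primalAffine_iff` and `slack_mem_costAffine`.

Everything is proved; there is no named fact. Ambient space: we work in all of `ℝ^{n×n}` with the symmetric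
bilinear pairing `frob M X = tr(M X)` of `SemidefiniteComplementarity` (on symmetric matrices this IS the
source's inner product; every proof below uses only bilinearity and symmetry of the pairing, self-adjointness
and idempotency of `P`, so nothing is lost by not restricting the carrier to `Sⁿ`; positive semidefinite
matrices are symmetric by definition). NOT HERE: the "primal–dual pair in ambient `S`" cone/perp identities
of Prop. 1 (`(Sⁿ₊ ∩ S)* ∩ S = Sⁿ₊ ∩ S`, which needs Unitality/positivity, §2.1–2.2), improving rays,
Condition 2 and §§3–5 (Jordan-algebra characterisation Thm 1, the closure algorithm Thm 2, combinatorial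
families Thms 5–6, optimal decompositions Thm 7).
-/

namespace Literature.Analysis.Convex.ConstraintSetInvariance

open Matrix
open scoped BigOperators
open Literature.Computation.Certificates.SemidefiniteComplementarity (frob IsPrimalFeasible slack
  frob_sub_left frob_sum_smul_left)

variable {n : Type*} [Fintype n] [DecidableEq n]

/-! ## §0 The trace pairing: bilinearity and symmetry -/

omit [DecidableEq n] in
/-- `⟨M, X⟩ = ⟨X, M⟩` (`tr(MX) = tr(XM)`). [cite: PermenterParrilo2016, §2 (trace inner-product)] -/
theorem frob_comm (M X : Matrix n n ℝ) : frob M X = frob X M := by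
  unfold frob; exact trace_mul_comm M X

omit [DecidableEq n] in
/-- Linearity in the second slot. [cite: PermenterParrilo2016, §2 (trace inner-product)] -/
theorem frob_sub_right (M X Z : Matrix n n ℝ) : frob M (X - Z) = frob M X - frob M Z := by
  simp [frob, Matrix.mul_sub, trace_sub]

omit [DecidableEq n] in
/-- Additivity in the second slot. [cite: PermenterParrilo2016, §2 (trace inner-product)] -/
theorem frob_add_right (M X Z : Matrix n n ℝ) : frob M (X + Z) = frob M X + frob M Z := by
  simp [frob, Matrix.mul_add, trace_add]

/-! ## §1 `L^⊥`, the affine constraint sets, Condition 1 -/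

/-- `L^⊥ = {S : ⟨S, Z⟩ = 0 ∀ Z ∈ L}` for the trace pairing. [cite: PermenterParrilo2016, §2 (sdp:main)] -/
def perp (L : Submodule ℝ (Matrix n n ℝ)) : Submodule ℝ (Matrix n n ℝ) where
  carrier := {S | ∀ Z ∈ L, frob S Z = 0}
  add_mem' := by
    intro S T hS hT Z hZ
    simp only [Set.mem_setOf_eq] at hS hT ⊢
    rw [show frob (S + T) Z = frob S Z + frob T Z by simp [frob, Matrix.add_mul, trace_add], hS Z hZ, hT Z hZ,
      add_zero]
  zero_mem' := by intro Z _; simp [frob]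
  smul_mem' := by
    intro c S hS Z hZ
    simp only [Set.mem_setOf_eq] at hS ⊢
    rw [show frob (c • S) Z = c * frob S Z by simp [frob, trace_smul], hS Z hZ, mul_zero]

/-- Membership in `L^⊥`. [cite: PermenterParrilo2016, §2 (sdp:main)] -/
theorem mem_perp_iff {L : Submodule ℝ (Matrix n n ℝ)} {S : Matrix n n ℝ} :
    S ∈ perp L ↔ ∀ Z ∈ L, frob S Z = 0 := Iff.rfl

/-- The primal affine set `Y + L = {X : X − Y ∈ L}`. [cite: PermenterParrilo2016, §2 (sdp:main)] -/
def primalAffine (Y : Matrix n n ℝ) (L : Submodule ℝ (Matrix n n ℝ)) : Set (Matrix n n ℝ) := {X | X - Y ∈ L}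

/-- The dual affine set `C + L^⊥ = {S : S − C ∈ L^⊥}`. [cite: PermenterParrilo2016, §2 (sdp:main)] -/
def dualAffine (C : Matrix n n ℝ) (L : Submodule ℝ (Matrix n n ℝ)) : Set (Matrix n n ℝ) := {S | S - C ∈ perp L}

omit [Fintype n] [DecidableEq n] in
/-- Membership in `Y + L`. [cite: PermenterParrilo2016, §2 (sdp:main)] -/
theorem mem_primalAffine_iff' {Y : Matrix n n ℝ} {L : Submodule ℝ (Matrix n n ℝ)} {X : Matrix n n ℝ} :
    X ∈ primalAffine Y L ↔ X - Y ∈ L := Iff.rfl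

/-- Membership in `C + L^⊥`. [cite: PermenterParrilo2016, §2 (sdp:main)] -/
theorem mem_dualAffine_iff {C : Matrix n n ℝ} {L : Submodule ℝ (Matrix n n ℝ)} {S : Matrix n n ℝ} :
    S ∈ dualAffine C L ↔ S - C ∈ perp L := Iff.rfl

omit [Fintype n] [DecidableEq n] in
/-- `Y ∈ Y + L`. [cite: PermenterParrilo2016, §2 (sdp:main)] -/
theorem self_mem_primalAffine (Y : Matrix n n ℝ) (L : Submodule ℝ (Matrix n n ℝ)) : Y ∈ primalAffine Y L := by
  simp [primalAffine]

/-- `C ∈ C + L^⊥`. [cite: PermenterParrilo2016, §2 (sdp:main)] -/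
theorem self_mem_dualAffine (C : Matrix n n ℝ) (L : Submodule ℝ (Matrix n n ℝ)) : C ∈ dualAffine C L := by
  simp [dualAffine]

/-- **Condition 1 (Constraint Set Invariance)** for a linear map `P` that is an orthogonal projection for the
trace pairing (self-adjoint and idempotent): (a) `P` is a positive map, (b) `P(Y + L) ⊆ Y + L`,
(c) `P(C + L^⊥) ⊆ C + L^⊥`. [cite: PermenterParrilo2016, §2 Condition 1] -/
structure IsCSIProjection (P : Matrix n n ℝ →ₗ[ℝ] Matrix n n ℝ) (C Y : Matrix n n ℝ)
    (L : Submodule ℝ (Matrix n n ℝ)) : Prop where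
  selfAdjoint : ∀ A B, frob (P A) B = frob A (P B)
  idempotent : ∀ A, P (P A) = P A
  pos : ∀ X, X.PosSemidef → (P X).PosSemidef
  primal : ∀ X ∈ primalAffine Y L, P X ∈ primalAffine Y L
  dual : ∀ S ∈ dualAffine C L, P S ∈ dualAffine C L

namespace IsCSIProjection

variable {P : Matrix n n ℝ →ₗ[ℝ] Matrix n n ℝ} {C Y : Matrix n n ℝ} {L : Submodule ℝ (Matrix n n ℝ)}

/-! ## §2 The mechanism: `X − P X ∈ L`, `C − P C ∈ L^⊥`, `P L ⊆ L`, `P L^⊥ ⊆ L^⊥` -/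

/-- (b) ⇒ `X − P_S(X) ∈ L` for `X ∈ Y + L`. [cite: PermenterParrilo2016, §2 (text before Prop. 1)] -/
theorem sub_proj_mem (h : IsCSIProjection P C Y L) {X : Matrix n n ℝ} (hX : X ∈ primalAffine Y L) :
    X - P X ∈ L := by
  have h1 : P X - Y ∈ L := h.primal X hX
  have h2 : X - Y ∈ L := hX
  have : X - P X = (X - Y) - (P X - Y) := by abel
  rw [this]; exact L.sub_mem h2 h1

/-- (c) ⇒ `S − P_S(S) ∈ L^⊥` for `S ∈ C + L^⊥`; in particular `C − P_S(C) ∈ L^⊥`.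
[cite: PermenterParrilo2016, §2 (text before Prop. 1)] -/
theorem sub_proj_mem_perp (h : IsCSIProjection P C Y L) {S : Matrix n n ℝ} (hS : S ∈ dualAffine C L) :
    S - P S ∈ perp L := by
  have h1 : P S - C ∈ perp L := h.dual S hS
  have h2 : S - C ∈ perp L := hS
  have : S - P S = (S - C) - (P S - C) := by abel
  rw [this]; exact (perp L).sub_mem h2 h1

/-- `C − P_S(C) ∈ L^⊥`. [cite: PermenterParrilo2016, §2 (text before Prop. 1)] -/
theorem cost_sub_proj_mem_perp (h : IsCSIProjection P C Y L) : C - P C ∈ perp L :=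
  h.sub_proj_mem_perp (self_mem_dualAffine C L)

/-- `Y − P_S(Y) ∈ L`. [cite: PermenterParrilo2016, §2 (text before Prop. 1)] -/
theorem rhs_sub_proj_mem (h : IsCSIProjection P C Y L) : Y - P Y ∈ L :=
  h.sub_proj_mem (self_mem_primalAffine Y L)

/-- (b) forces `P_S(L) ⊆ L` (apply (b) to `Y + Z` and to `Y`). [cite: PermenterParrilo2016, §2 eq. (affinter)] -/
theorem map_mem (h : IsCSIProjection P C Y L) {Z : Matrix n n ℝ} (hZ : Z ∈ L) : P Z ∈ L := by
  have h1 : P (Y + Z) - Y ∈ L := h.primal (Y + Z) (by simp [primalAffine, hZ])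
  have h2 : P Y - Y ∈ L := h.primal Y (self_mem_primalAffine Y L)
  have : P Z = (P (Y + Z) - Y) - (P Y - Y) := by rw [map_add]; abel
  rw [this]; exact L.sub_mem h1 h2

/-- (c) forces `P_S(L^⊥) ⊆ L^⊥`. [cite: PermenterParrilo2016, §2 eq. (affinter)] -/
theorem map_mem_perp (h : IsCSIProjection P C Y L) {Z : Matrix n n ℝ} (hZ : Z ∈ perp L) :
    P Z ∈ perp L := by
  have h1 : P (C + Z) - C ∈ perp L := h.dual (C + Z) (by simp [dualAffine, hZ])
  have h2 : P C - C ∈ perp L := h.dual C (self_mem_dualAffine C L)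
  have : P Z = (P (C + Z) - C) - (P C - C) := by rw [map_add]; abel
  rw [this]; exact (perp L).sub_mem h1 h2

/-! ## §3 Equal cost; feasible ↦ feasible -/

/-- **Equal primal cost**: "`C · X = P_S(C) · P_S(X) = C · P_S P_S(X) = C · P_S(X)`. Hence, `P_S` maps a primal
feasible point `X` to a primal feasible point with equal cost." (from `⟨C − P C, X − P X⟩ = 0`, `L ⟂ L^⊥`).
[cite: PermenterParrilo2016, §2 (text before Prop. 1)] -/
theorem frob_cost_proj (h : IsCSIProjection P C Y L) {X : Matrix n n ℝ} (hX : X ∈ primalAffine Y L) :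
    frob C (P X) = frob C X := by
  have h0 : frob (C - P C) (X - P X) = 0 := h.cost_sub_proj_mem_perp (X - P X) (h.sub_proj_mem hX)
  have e1 : frob (P C) X = frob C (P X) := h.selfAdjoint C X
  have e2 : frob (P C) (P X) = frob C (P X) := by rw [h.selfAdjoint C (P X), h.idempotent X]
  rw [frob_sub_left, frob_sub_right, frob_sub_right, e1, e2] at h0
  linarith

/-- **Equal dual cost**: "`P_S` also maps a dual feasible point `S` to a dual feasible point `P_S(S)` with equal
cost", `⟨Y, P S⟩ = ⟨Y, S⟩` for `S ∈ C + L^⊥`. [cite: PermenterParrilo2016, §2 (text before Prop. 1)] -/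
theorem frob_rhs_proj (h : IsCSIProjection P C Y L) {S : Matrix n n ℝ} (hS : S ∈ dualAffine C L) :
    frob Y (P S) = frob Y S := by
  have h0 : frob (S - P S) (Y - P Y) = 0 := h.sub_proj_mem_perp hS (Y - P Y) h.rhs_sub_proj_mem
  have e1 : frob (P S) Y = frob S (P Y) := h.selfAdjoint S Y
  have e2 : frob (P S) (P Y) = frob S (P Y) := by rw [h.selfAdjoint S (P Y), h.idempotent Y]
  rw [frob_sub_left, frob_sub_right, frob_sub_right, e1, e2] at h0
  rw [frob_comm Y (P S), frob_comm Y S, h.selfAdjoint S Y]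
  linarith

/-- Primal feasible ↦ primal feasible (in the range of `P`). [cite: PermenterParrilo2016, §2 Prop. 1] -/
theorem primalFeasible_proj (h : IsCSIProjection P C Y L) {X : Matrix n n ℝ}
    (hX : X ∈ primalAffine Y L ∧ X.PosSemidef) : P X ∈ primalAffine Y L ∧ (P X).PosSemidef :=
  ⟨h.primal X hX.1, h.pos X hX.2⟩

/-- Dual feasible ↦ dual feasible (in the range of `P`). [cite: PermenterParrilo2016, §2 Prop. 1] -/
theorem dualFeasible_proj (h : IsCSIProjection P C Y L) {S : Matrix n n ℝ}
    (hS : S ∈ dualAffine C L ∧ S.PosSemidef) : P S ∈ dualAffine C L ∧ (P S).PosSemidef :=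
  ⟨h.dual S hS.1, h.pos S hS.2⟩

/-! ## §4 Proposition 1: equal values, optimal ↦ optimal, the restricted affine sets -/

/-- **Proposition 1, primal values**: the objective values attained on the primal feasible set and on its
restriction to `S = range P_S = {X : P X = X}` coincide ("the primal optimal value equals the primal optimal
value of (sdp:main)"; feasible iff feasible; attained iff attained). [cite: PermenterParrilo2016, §2 Prop. 1] -/
theorem primal_values_eq (h : IsCSIProjection P C Y L) :
    (fun X => frob C X) '' {X | (X ∈ primalAffine Y L ∧ X.PosSemidef) ∧ P X = X} =
      (fun X => frob C X) '' {X | X ∈ primalAffine Y L ∧ X.PosSemidef} := by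
  apply Set.Subset.antisymm
  · exact Set.image_mono fun X hX => hX.1
  · rintro _ ⟨X, hX, rfl⟩
    exact ⟨P X, ⟨h.primalFeasible_proj hX, h.idempotent X⟩, h.frob_cost_proj hX.1⟩

/-- **Proposition 1, dual values** (objective `−⟨Y, S⟩`): the dual values on the dual feasible set and on its
restriction to `range P_S` coincide. [cite: PermenterParrilo2016, §2 Prop. 1] -/
theorem dual_values_eq (h : IsCSIProjection P C Y L) :
    (fun S => -frob Y S) '' {S | (S ∈ dualAffine C L ∧ S.PosSemidef) ∧ P S = S} =
      (fun S => -frob Y S) '' {S | S ∈ dualAffine C L ∧ S.PosSemidef} := by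
  apply Set.Subset.antisymm
  · exact Set.image_mono fun S hS => hS.1
  · rintro _ ⟨S, hS, rfl⟩
    exact ⟨P S, ⟨h.dualFeasible_proj hS, h.idempotent S⟩, by simp only [h.frob_rhs_proj hS.1]⟩

/-- **Optimal ↦ optimal (primal)**: if `X` minimises `⟨C, ·⟩` over the primal feasible set then so does
`P_S(X)`, which lies in `S`. [cite: PermenterParrilo2016, §2 (text before Prop. 1), Prop. 1] -/
theorem isMinOn_proj (h : IsCSIProjection P C Y L) {X : Matrix n n ℝ}
    (hX : X ∈ primalAffine Y L ∧ X.PosSemidef)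
    (hmin : IsMinOn (fun X' => frob C X') {X' | X' ∈ primalAffine Y L ∧ X'.PosSemidef} X) :
    (P X ∈ primalAffine Y L ∧ (P X).PosSemidef) ∧ P (P X) = P X ∧
      IsMinOn (fun X' => frob C X') {X' | X' ∈ primalAffine Y L ∧ X'.PosSemidef} (P X) := by
  refine ⟨h.primalFeasible_proj hX, h.idempotent X, fun X' hX' => ?_⟩
  have := hmin hX'
  simp only [Set.mem_setOf_eq] at this ⊢
  rwa [h.frob_cost_proj hX.1]

/-- **Optimal ↦ optimal (dual)**: if `S` maximises `−⟨Y, ·⟩` over the dual feasible set then so does `P_S(S)`.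
[cite: PermenterParrilo2016, §2 (text before Prop. 1), Prop. 1] -/
theorem isMaxOn_proj (h : IsCSIProjection P C Y L) {S : Matrix n n ℝ}
    (hS : S ∈ dualAffine C L ∧ S.PosSemidef)
    (hmax : IsMaxOn (fun S' => -frob Y S') {S' | S' ∈ dualAffine C L ∧ S'.PosSemidef} S) :
    (P S ∈ dualAffine C L ∧ (P S).PosSemidef) ∧ P (P S) = P S ∧
      IsMaxOn (fun S' => -frob Y S') {S' | S' ∈ dualAffine C L ∧ S'.PosSemidef} (P S) := by
  refine ⟨h.dualFeasible_proj hS, h.idempotent S, fun S' hS' => ?_⟩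
  have := hmax hS'
  simp only [Set.mem_setOf_eq] at this ⊢
  rwa [h.frob_rhs_proj hS.1]

/-- (affinter), primal: `(Y + L) ∩ S = P_S(Y) + L ∩ S` with `S = range P_S`.
[cite: PermenterParrilo2016, §2 eq. (affinter)] -/
theorem primalAffine_inter_range_eq (h : IsCSIProjection P C Y L) :
    {X | X ∈ primalAffine Y L ∧ P X = X} = {X | ∃ Z, (Z ∈ L ∧ P Z = Z) ∧ X = P Y + Z} := by
  ext X
  simp only [Set.mem_setOf_eq]
  constructor
  · rintro ⟨hX, hPX⟩
    refine ⟨X - P Y, ⟨?_, ?_⟩, by abel⟩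
    · have : X - P Y = P (X - Y) := by rw [map_sub, hPX]
      rw [this]; exact h.map_mem hX
    · rw [map_sub, hPX, h.idempotent Y]
  · rintro ⟨Z, ⟨hZ, hPZ⟩, rfl⟩
    refine ⟨?_, by rw [map_add, h.idempotent Y, hPZ]⟩
    show P Y + Z - Y ∈ L
    have : P Y + Z - Y = Z - (Y - P Y) := by abel
    rw [this]; exact L.sub_mem hZ h.rhs_sub_proj_mem

/-- (affinter), dual: `(C + L^⊥) ∩ S = P_S(C) + L^⊥ ∩ S`. [cite: PermenterParrilo2016, §2 eq. (affinter)] -/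
theorem dualAffine_inter_range_eq (h : IsCSIProjection P C Y L) :
    {S | S ∈ dualAffine C L ∧ P S = S} = {S | ∃ Z, (Z ∈ perp L ∧ P Z = Z) ∧ S = P C + Z} := by
  ext S
  simp only [Set.mem_setOf_eq]
  constructor
  · rintro ⟨hS, hPS⟩
    refine ⟨S - P C, ⟨?_, ?_⟩, by abel⟩
    · have : S - P C = P (S - C) := by rw [map_sub, hPS]
      rw [this]; exact h.map_mem_perp hS
    · rw [map_sub, hPS, h.idempotent C]
  · rintro ⟨Z, ⟨hZ, hPZ⟩, rfl⟩
    refine ⟨?_, by rw [map_add, h.idempotent C, hPZ]⟩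
    show P C + Z - C ∈ perp L
    have : P C + Z - C = Z - (C - P C) := by abel
    rw [this]; exact (perp L).sub_mem hZ h.cost_sub_proj_mem_perp

/-! ## §5 Remark 1: the Reynolds-operator case -/

/-- **Remark 1**: "in symmetry reduction, the Reynolds operator satisfies constraints (a-b) and (typically)
`P_S(C) = C`. It turns out these constraints imply (a-c)": a self-adjoint idempotent positive `P` with
`P(Y + L) ⊆ Y + L` and `P C = C` satisfies Condition 1. [cite: PermenterParrilo2016, §2 Remark 1] -/
theorem of_reynolds (hsa : ∀ A B, frob (P A) B = frob A (P B)) (hid : ∀ A, P (P A) = P A)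
    (hpos : ∀ X, X.PosSemidef → (P X).PosSemidef) (hprimal : ∀ X ∈ primalAffine Y L, P X ∈ primalAffine Y L)
    (hC : P C = C) : IsCSIProjection P C Y L := by
  refine ⟨hsa, hid, hpos, hprimal, fun S hS => ?_⟩
  -- `P L ⊆ L` from (b), exactly as in `map_mem`
  have hmap : ∀ Z ∈ L, P Z ∈ L := by
    intro Z hZ
    have h1 : P (Y + Z) - Y ∈ L := hprimal (Y + Z) (by simp [primalAffine, hZ])
    have h2 : P Y - Y ∈ L := hprimal Y (self_mem_primalAffine Y L)
    have : P Z = (P (Y + Z) - Y) - (P Y - Y) := by rw [map_add]; abel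
    rw [this]; exact L.sub_mem h1 h2
  -- (c): `⟨P S − C, Z⟩ = ⟨P (S − C), Z⟩ = ⟨S − C, P Z⟩ = 0`
  intro Z hZ
  have : P S - C = P (S - C) := by rw [map_sub, hC]
  rw [this, hsa]
  exact hS (P Z) (hmap Z hZ)

end IsCSIProjection

/-! ## §6 Bridge to the standard form `⟨Aᵢ, X⟩ = bᵢ` -/

section StandardForm

variable {ι : Type*} [Fintype ι]

/-- The nullspace `L_A = {X : ⟨Aᵢ, X⟩ = 0 ∀ i}` of the constraint map. [cite: PermenterParrilo2016, §2 (sdp:main)] -/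
def nullspace (A : ι → Matrix n n ℝ) : Submodule ℝ (Matrix n n ℝ) where
  carrier := {X | ∀ i, frob (A i) X = 0}
  add_mem' := by
    intro X Z hX hZ i
    simp only [Set.mem_setOf_eq] at hX hZ ⊢
    rw [frob_add_right, hX i, hZ i, add_zero]
  zero_mem' := by intro i; simp [frob]
  smul_mem' := by
    intro c X hX i
    simp only [Set.mem_setOf_eq] at hX ⊢
    rw [show frob (A i) (c • X) = c * frob (A i) X by simp [frob, trace_smul], hX i, mul_zero]

omit [Fintype ι] in
/-- With `Y` a particular solution (`⟨Aᵢ, Y⟩ = bᵢ`), `X ∈ Y + L_A ⟺ ⟨Aᵢ, X⟩ = bᵢ ∀ i`; so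
`IsPrimalFeasible A b X ⟺ X ⪰ 0 ∧ X ∈ Y + L_A`. [cite: PermenterParrilo2016, §2 (sdp:main)] -/
theorem mem_primalAffine_iff {A : ι → Matrix n n ℝ} {b : ι → ℝ} {Y : Matrix n n ℝ} (hY : ∀ i, frob (A i) Y = b i)
    (X : Matrix n n ℝ) : X ∈ primalAffine Y (nullspace A) ↔ ∀ i, frob (A i) X = b i := by
  simp only [primalAffine, Set.mem_setOf_eq]
  show (∀ i, frob (A i) (X - Y) = 0) ↔ _
  refine forall_congr' fun i => ?_
  rw [frob_sub_right, hY i, sub_eq_zero]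

omit [Fintype ι] in
/-- `IsPrimalFeasible A b X ⟺ X ∈ Y + L_A ∧ X ⪰ 0` for a particular solution `Y`. [cite: PermenterParrilo2016, §2 (sdp:main)] -/
theorem isPrimalFeasible_iff {A : ι → Matrix n n ℝ} {b : ι → ℝ} {Y : Matrix n n ℝ} (hY : ∀ i, frob (A i) Y = b i)
    (X : Matrix n n ℝ) : IsPrimalFeasible A b X ↔ X ∈ primalAffine Y (nullspace A) ∧ X.PosSemidef := by
  rw [mem_primalAffine_iff hY]; exact ⟨fun h => ⟨h.2, h.1⟩, fun h => ⟨h.2, h.1⟩⟩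

/-- Every standard-form dual slack `C − Σ yᵢ Aᵢ` lies in `C + L_A^⊥` (the easy inclusion `range A* ⊆ (ker A)^⊥`).
[cite: PermenterParrilo2016, §2 (sdp:main)] -/
theorem slack_mem_costAffine (C : Matrix n n ℝ) (A : ι → Matrix n n ℝ) (y : ι → ℝ) :
    slack C A y ∈ dualAffine C (nullspace A) := by
  intro Z hZ
  have hZ' : ∀ i, frob (A i) Z = 0 := hZ
  have e : slack C A y - C = -(∑ i, y i • A i) := by rw [slack]; abel
  have e2 : frob (-(∑ i, y i • A i)) Z = -frob (∑ i, y i • A i) Z := by simp [frob]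
  rw [e, e2, frob_sum_smul_left, neg_eq_zero]
  exact Finset.sum_eq_zero fun i _ => by rw [hZ' i, mul_zero]

end StandardForm

end Literature.Analysis.Convex.ConstraintSetInvariance
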